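import Mathlib
import Summits.ABC.ABC.Theorems.ThreeSlotZooSquareRung

/-!
# The one-slot even-power rung (completes the square case of the one-slot zoo shape)

`1 + 2^x · q^y = r^(2m)` with `q, r` prime, `y ≥ 1`, `m ≥ 2` has the single solution
`1 + 2⁴·5 = 3⁴ = 81` (the E-3SLOT champion of quality `1.2920`); together with
`ThreeSlotZooSquareRung.zooSquareRung` (`m = 1`) this gives the ε-free abc inequality
`c ≤ 5 · rad(abc)` on the whole one-slot shape with `c` a perfect square: `1 + 2^x q^y = r^(2m)`,
`m ≥ 1`.  Tools: the `(R-1)(R+1)` descent of the square rung run with `R = r^m`, and Mihăilescu's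
theorem (`mihailescu_holds`) at the two exits.
-/

namespace Summit.ABC.ABC.Theorems.ThreeSlotZooEvenPowerRung

open Literature.NumberTheory.DiophantineGeometry UniqueFactorizationMonoid
open Summit.ABC.ABC.Theorems.ThreeSlotZooSquareRung

/-- Classification for `m ≥ 2` in the main case (`q` odd, `x ≥ 1`): only `81 = 1 + 80`. -/
theorem coreEven {x y q r m : ℕ} (hq : q.Prime) (hr : r.Prime) (hq2 : q ≠ 2) (hx : 1 ≤ x)
    (hy : 1 ≤ y) (hm : 2 ≤ m) (h : 1 + 2 ^ x * q ^ y = (r ^ m) ^ 2) :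
    x = 4 ∧ q = 5 ∧ y = 1 ∧ r = 3 ∧ m = 2 := by
  have hR4 : 4 ≤ r ^ m := le_trans (by norm_num) (four_le_pow hr.two_le hm)
  set R := r ^ m with hRdef
  have hq3 : 3 ≤ q := by
    rcases hq.eq_two_or_odd' with h2 | hodd
    · exact absurd h2 hq2
    · have := hq.two_le; rcases hodd with ⟨k, hk⟩; omega
  have hqpos : 0 < q ^ y := pow_pos hq.pos y
  have hqy3 : 3 ≤ q ^ y := by
    calc 3 ≤ q := hq3
      _ = q ^ 1 := (pow_one q).symm
      _ ≤ q ^ y := Nat.pow_le_pow_right hq.pos hy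
  -- R is odd
  have hRodd : Odd R := by
    have h2 : 2 ∣ 2 ^ x * q ^ y := dvd_mul_of_dvd_left (dvd_pow_self 2 (by omega)) _
    have hsq : Odd (R ^ 2) := by
      obtain ⟨w, hw⟩ := h2
      exact ⟨w, by rw [← h, hw]; ring⟩
    exact (Nat.odd_pow_iff (by norm_num)).mp hsq
  obtain ⟨k, hk⟩ := hRodd
  have hk1 : 1 ≤ k := by omega
  -- 2^x q^y = 4 k (k+1)
  have hprod0 : 2 ^ x * q ^ y = 4 * (k * (k + 1)) := by
    rw [hk] at h; ring_nf at h; ring_nf; omega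
  -- x ≥ 2
  have hx2 : 2 ≤ x := by
    by_contra hx2
    have hx1 : x = 1 := by omega
    subst hx1
    have hqy : q ^ y = 2 * (k * (k + 1)) := by omega
    have h2 : 2 ∣ q ^ y := ⟨_, hqy⟩
    have h2q := Nat.prime_two.dvd_of_dvd_pow h2
    have := (Nat.prime_dvd_prime_iff_eq Nat.prime_two hq).mp h2q
    exact hq2 this.symm
  obtain ⟨a, rfl⟩ : ∃ a, x = a + 2 := ⟨x - 2, by omega⟩
  have hprod : k * (k + 1) = 2 ^ a * q ^ y := by
    have h4 : 4 * (2 ^ a * q ^ y) = 4 * (k * (k + 1)) := by rw [← hprod0]; ring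
    omega
  have hqy_dvd : q ^ y ∣ k * (k + 1) := ⟨2 ^ a, by rw [hprod]; ring⟩
  by_cases hqk1 : q ∣ k + 1
  · -- Case B: q ∤ k, so q^y ∣ k + 1, k + 1 = q^y, k = 2^a
    have hqk : ¬ q ∣ k := by
      intro hqk
      have h1 : q ∣ 1 := (Nat.dvd_add_right hqk).mp hqk1
      exact hq.one_lt.ne' (Nat.dvd_one.mp h1)
    have hcopB : Nat.Coprime (q ^ y) k := (hq.coprime_iff_not_dvd.mpr hqk).pow_left y
    obtain ⟨t, ht⟩ : q ^ y ∣ k + 1 := hcopB.dvd_of_dvd_mul_left hqy_dvd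
    have hkt : k * t = 2 ^ a := by
      have h1 : q ^ y * (k * t) = q ^ y * 2 ^ a := by
        calc q ^ y * (k * t) = k * (q ^ y * t) := by ring
          _ = k * (k + 1) := by rw [ht]
          _ = 2 ^ a * q ^ y := hprod
          _ = q ^ y * 2 ^ a := by ring
      exact Nat.eq_of_mul_eq_mul_left hqpos h1
    obtain ⟨i, -, hki⟩ := (Nat.dvd_prime_pow Nat.prime_two).mp (⟨t, hkt.symm⟩ : k ∣ 2 ^ a)
    obtain ⟨j, -, htj⟩ := (Nat.dvd_prime_pow Nat.prime_two).mp (⟨k, by rw [← hkt]; ring⟩ : t ∣ 2 ^ a)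
    -- t = 1
    have ht1 : t = 1 := by
      rcases j with _ | j
      · simpa using htj
      · exfalso
        have h2t : 2 ∣ t := by rw [htj]; exact dvd_pow_self 2 (by omega)
        rcases i with _ | i
        · -- k = 1: then 2 = q^y * t, impossible
          have hk1' : k = 1 := by simpa using hki
          rw [hk1'] at ht
          have : q ^ y ∣ 2 := ⟨t, ht⟩
          have := Nat.le_of_dvd (by norm_num) this
          omega
        · have h2k : 2 ∣ k := by rw [hki]; exact dvd_pow_self 2 (by omega)
          have h2k1 : 2 ∣ k + 1 := by rw [ht]; exact dvd_mul_of_dvd_right h2t _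
          omega
    rw [ht1, mul_one] at ht hkt
    -- now k + 1 = q ^ y and k = 2 ^ a, so r ^ m = 2 ^ (a + 1) + 1: Mihăilescu
    have hRm : r ^ m = 2 ^ (a + 1) + 1 := by rw [← hRdef, hk, hkt]; ring
    obtain ⟨hr3, hm2, ha⟩ := pow_eq_two_pow_add_one hr.two_le hm hRm
    have ha2 : a = 2 := by omega
    subst ha2 hr3 hm2
    have hk4 : k = 4 := by rw [hkt]; norm_num
    rw [hk4] at ht
    have hq5 : q ^ y = 5 := by omega
    obtain ⟨hq5', hy1⟩ := (Nat.Prime.pow_eq_iff (by norm_num : Nat.Prime 5)).mp hq5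
    exact ⟨rfl, hq5', hy1, rfl, rfl⟩
  · -- Case A: q^y ∣ k, k = q^y, k + 1 = 2^a
    have hcopA : Nat.Coprime (q ^ y) (k + 1) := (hq.coprime_iff_not_dvd.mpr hqk1).pow_left y
    obtain ⟨t, ht⟩ : q ^ y ∣ k := hcopA.dvd_of_dvd_mul_right hqy_dvd
    have hkt : (k + 1) * t = 2 ^ a := by
      have h1 : q ^ y * ((k + 1) * t) = q ^ y * 2 ^ a := by
        calc q ^ y * ((k + 1) * t) = (q ^ y * t) * (k + 1) := by ring
          _ = k * (k + 1) := by rw [ht]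
          _ = 2 ^ a * q ^ y := hprod
          _ = q ^ y * 2 ^ a := by ring
      exact Nat.eq_of_mul_eq_mul_left hqpos h1
    obtain ⟨i, -, hki⟩ := (Nat.dvd_prime_pow Nat.prime_two).mp (⟨t, hkt.symm⟩ : k + 1 ∣ 2 ^ a)
    obtain ⟨j, -, htj⟩ := (Nat.dvd_prime_pow Nat.prime_two).mp (⟨k + 1, by rw [← hkt]; ring⟩ : t ∣ 2 ^ a)
    have ht1 : t = 1 := by
      rcases j with _ | j
      · simpa using htj
      · exfalso
        have h2t : 2 ∣ t := by rw [htj]; exact dvd_pow_self 2 (by omega)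
        rcases i with _ | i
        · simp at hki; omega
        · have h2k1 : 2 ∣ k + 1 := by rw [hki]; exact dvd_pow_self 2 (by omega)
          have h2k : 2 ∣ k := by rw [ht]; exact dvd_mul_of_dvd_right h2t _
          omega
    rw [ht1, mul_one] at ht hkt
    -- now k = q ^ y and k + 1 = 2 ^ a, so r ^ m + 1 = 2 ^ (a + 1): impossible by Mihăilescu
    exfalso
    refine pow_add_one_ne_two_pow hr.two_le hm (m := a + 1) ?_
    rw [← hRdef, hk, pow_succ]
    omega


/-- Classification for `m ≥ 2`, all parameters: only `1 + 2⁴ · 5 = 3⁴`. -/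
theorem evenPower_classification {x y q r m : ℕ} (hq : q.Prime) (hr : r.Prime) (hy : 1 ≤ y)
    (hm : 2 ≤ m) (h : 1 + 2 ^ x * q ^ y = r ^ (2 * m)) :
    x = 4 ∧ q = 5 ∧ y = 1 ∧ r = 3 ∧ m = 2 := by
  have hR2 : r ^ (2 * m) = (r ^ m) ^ 2 := by rw [← pow_mul, mul_comm]
  rw [hR2] at h
  have hR4 : 4 ≤ r ^ m := le_trans (by norm_num) (four_le_pow hr.two_le hm)
  by_cases hq2 : q = 2
  · -- q = 2: (r^m)² = 2^(x+y) + 1 forces r^m = 3, absurd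
    exfalso
    subst hq2
    have h' : (r ^ m) ^ 2 = 2 ^ (x + y) + 1 := by rw [pow_add]; omega
    have hxy : 2 ≤ x + y := by
      by_contra hxy
      have : x + y = 1 := by omega
      rw [this] at h'
      nlinarith
    obtain ⟨hr3, -, -, -⟩ :=
      mihailescu_holds (x := r ^ m) (y := 2) (a := 2) (b := x + y) (by norm_num) le_rfl hxy h'
    omega
  by_cases hx : x = 0
  · exfalso
    subst hx
    have h' : (r ^ m) ^ 2 = q ^ y + 1 := by simp at h; omega
    rcases Nat.lt_or_ge y 2 with hy1 | hy2
    · have hy1' : y = 1 := by omega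
      subst hy1'
      rw [pow_one] at h'
      -- q = (R-1)(R+1) prime forces R = 2, absurd
      obtain ⟨R0, hR0⟩ : ∃ R0, r ^ m = R0 + 2 := ⟨r ^ m - 2, by omega⟩
      rw [hR0] at h'
      have hfac : q = (R0 + 1) * (R0 + 3) := by nlinarith
      have := (Nat.prime_mul_iff.mp (hfac ▸ hq))
      rcases this with ⟨-, h1⟩ | ⟨-, h1⟩ <;> omega
    · obtain ⟨-, -, hq2', -⟩ := mihailescu_holds (x := r ^ m) (y := q) (a := 2) (b := y) hq.pos le_rfl hy2 h'
      exact hq2 hq2'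
  exact coreEven hq hr hq2 (by omega) hy hm h

/-- **The even-power rung**: ε-free abc with constant `5` on the one-slot shape with `c` a perfect
square, `1 + 2^x q^y = r^(2m)` (`q, r` prime, `y, m ≥ 1`). -/
theorem zooEvenPowerRung : ∀ x y q r m : ℕ, q.Prime → r.Prime → 1 ≤ y → 1 ≤ m →
    1 + 2 ^ x * q ^ y = r ^ (2 * m) → r ^ (2 * m) ≤ 5 * rad 1 (2 ^ x * q ^ y) (r ^ (2 * m)) := by
  intro x y q r m hq hr hy hm h
  rcases Nat.lt_or_ge m 2 with hm1 | hm2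
  · have hm1' : m = 1 := by omega
    subst hm1'
    simpa using zooSquareRung x y q r hq hr hy (by simpa using h)
  · obtain ⟨rfl, rfl, rfl, rfl, rfl⟩ := evenPower_classification hq hr hy hm2 h
    -- the triple (1, 80, 81): rad = 30
    have hn0 : (1 * (2 ^ 4 * 5 ^ 1) * 3 ^ (2 * 2) : ℕ) ≠ 0 := by norm_num
    have h2 : 2 ∣ radical (1 * (2 ^ 4 * 5 ^ 1) * 3 ^ (2 * 2)) :=
      (dvd_radical_iff_of_irreducible Nat.prime_two hn0).mpr (by norm_num)
    have h3 : 3 ∣ radical (1 * (2 ^ 4 * 5 ^ 1) * 3 ^ (2 * 2)) :=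
      (dvd_radical_iff_of_irreducible Nat.prime_three hn0).mpr (by norm_num)
    have h5 : 5 ∣ radical (1 * (2 ^ 4 * 5 ^ 1) * 3 ^ (2 * 2)) :=
      (dvd_radical_iff_of_irreducible Nat.prime_five hn0).mpr (by norm_num)
    have h30 : 2 * 3 * 5 ∣ radical (1 * (2 ^ 4 * 5 ^ 1) * 3 ^ (2 * 2)) :=
      (Nat.Coprime.mul_left (by norm_num : Nat.Coprime 2 5) (by norm_num : Nat.Coprime 3 5)).mul_dvd_of_dvd_of_dvd
        ((by norm_num : Nat.Coprime 2 3).mul_dvd_of_dvd_of_dvd h2 h3) h5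
    rw [rad_def]
    have := Nat.le_of_dvd (Nat.pos_of_ne_zero radical_ne_zero) h30
    omega

end Summit.ABC.ABC.Theorems.ThreeSlotZooEvenPowerRung
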